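import Literature.MathematicalPhysics.QuantumLattice.HubbardNNNHoppingWindowCertificateD4
import Literature.MathematicalPhysics.QuantumLattice.HubbardTTPrimeGrandCanonicalThermalStatesKMSRows
import Literature.MathematicalPhysics.QuantumLattice.HubbardWave0RepulsiveProofs
import Literature.MathematicalPhysics.QuantumLattice.HubbardWave0LiebProofs
import Literature.MathematicalPhysics.QuantumLattice.HubbardLocalSpinOperators
import Literature.MathematicalPhysics.QuantumLattice.FreeFermiGasNoPairFieldLRO
import HarnessLib

/-!
# SU(2)-Ward × affine-`D₄` window certificates for the `t–t'` Hubbard model: soundness on every large torus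

HONEST FRAMING: first certified bounds; not a superconductivity verdict. This file proves NO number: it is the
SOUNDNESS theorem for window certificates that use, in addition to everything
`HubbardNNNHoppingWindowCertificateD4.groundEnergy_hubbardTorusTT'_div_ge_of_window_certificate_d4` admits
(Gram/SOS positivity, eom commutators `[H_{Λ'}, B]`, affine-`D₄` identifications, `U(1)×U(1)`-charged ladder words,
anti-Hermitian parts, ladder-word slack), the **SU(2)-Ward null family** `Σ_r (S⁺_{Λ'} X_r − X_r S⁺_{Λ'}) +
Σ_r (S⁻_{Λ'} X'_r − X'_r S⁻_{Λ'})` with ARBITRARY `X_r, X'_r ∈ 𝔄_{Λ'}` — the rows `ω([S^±, X]) = 0` that every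
symmetry-reduced `t–t'` bootstrap certificate of record carries (Han 2020 §2 "null constraints from symmetries and
conserved charges"; the programs CORE #294 / MENU #529 have 12 170 / 1 660 885 such rows) and for which the tree had
no slot: the engine `torus_minEnergyOn_div_ge_of_local_certificate` reads the certificate in `szSector (2n) 0`, which
`S^±` do not preserve. Here the certificate is read in the FULL `2n`-particle sector `nParticleSubmodule (2n)` (all
`S^z`), through the generic-sector engine (hypothesis `hgen` = the statement of
`HubbardTorusGenericSectorCertificate.torus_minEnergyOn_div_ge_of_local_certificate_generic`, kept as a hypothesis here;
the unconditional torus / thermodynamic-limit forms follow in the sibling `HubbardNNNHoppingWindowCertificateWardD4TL`).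

Content (everything PROVED; no definitions except the file-local `DecidableEq (FermionTorus d L)` instance):
* `mulVec_mem_nParticleSubmodule_of_commute` and corollaries — the `N`-particle sector is invariant under every
  operator commuting with `N̂`: `S⁺`, `S⁻`, `S^z`, the `t–t'` torus Hamiltonian, the translation and affine-`D₄`
  unitaries and their adjoints; `N̂ = N` on it; it contains `szSector`, hence is `≠ ⊥`; `groundEnergy = minEnergyOn`;
* `spinPlus_commutator_fermionEmbed_toTorusEmb` / `spinMinus_…` — `S^± ΓA − ΓA S^± = Γ(S^±_Λ A − A S^±_Λ)`
  (on-site terms off the image are even and far: `sum_commutator_fermionEmbed_toTorusEmb`);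
* `hubbardTorusTT'_commute_spinPlus` / `…spinMinus`;
* `wardD4TorusCert_of_genericSectorTorusCert` — THE THEOREM: with ONE multiplier `μ` on `n_{0↑} + n_{0↓}` (target
  `n`; `N̂` is the scalar `2nh` on the sector) and the two Ward families,
  `c − Σₖ ‖aₖ‖ + μ ((2nh)/L² − n) ≤ groundEnergy (hubbardTorusTT' L t t' U) (2nh) / L²` for every `L ≥ 3` with
  `x ↦ x mod L` injective on `thicken Λ' 1` and `nh ≤ L²`. Its binder list is LITERALLY the body of the Ventures
  crux-line stub `wardk.stub_wardTorus_of_generic : GenericSectorTorusCert → WardD4TorusCert` (item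
  stmt-Ventures-21721 / 22024, hub-lb team lb-sym), which therefore closes by `exact`; the thermodynamic limit is
  `HubbardTTPrimeTorusFamilyTransport.energyDensityTT'_ge_of_torus_family_bound`.

Proof = the proof of the `D₄` theorem with `K = szSector` replaced by `K = nParticleSubmodule (2nh)`, charged words as
commutators with `N̂`/`S^z` as there, and the Ward families as commutators with `S⁺`/`S⁻` in the same slot. Written by
hub-lb-sym-eng-3 (team lb-sym). No summit statement is proved here; a certified bound is a number with a certificate;
nothing here predicts superconductivity.

## References
* X. Han, *Quantum many-body bootstrap*, arXiv:2006.06002 (2020), §2 (null constraints from symmetries and conserved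
  charges), §3. [cite: Han2020Bootstrap, §3]
* E. H. Lieb, PRL 62 (1989) 1201 (`[H, S^±] = 0`, `SU(2)` of the Hubbard model). [cite: LiebPRL1989, eq. (2)]
* O. Bratteli, D. W. Robinson, *Operator Algebras and Quantum Statistical Mechanics II*, Thm. 6.2.4 (graded locality).
  [cite: BratteliRobinsonII1997, Thm. 6.2.4]
* H. Tasaki, *Physics and Mathematics of Quantum Many-Body Systems* (2020), §9.2 (number sectors). [cite: Tasaki2020, §9.2]
-/
noncomputable section

namespace Literature.MathematicalPhysics.QuantumLattice

open Matrix Finset HubbardWave0 Literature.Probability.LatticeModels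
open Literature.MathematicalPhysics.QuantumManyBody.StateRelaxation
open scoped ComplexOrder BigOperators

/-! ### The `N`-particle sector is invariant under everything that commutes with `N̂` -/

section NSector

variable {Λ : Type*} [LinearOrder Λ] [Fintype Λ]

/-- An operator commuting with the particle number `N̂` maps the `N`-particle sector into itself
(`nParticleSubmodule N` is the `N`-eigenspace of `N̂`). Tasaki (2020) §9.2. [cite: Tasaki2020, §9.2] -/
theorem mulVec_mem_nParticleSubmodule_of_commute {A : Matrix (Finset (Orb Λ)) (Finset (Orb Λ)) ℂ}
    (hN : Commute A totalNumber) {N : ℕ} {v : Fock (Orb Λ)} (hv : v ∈ nParticleSubmodule N) :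
    A *ᵥ v ∈ nParticleSubmodule N := by
  rw [nParticleSubmodule_eq_eigenspace_holds N] at hv ⊢
  have hN' : Commute A (totalNumberOp : Matrix (Finset (Orb Λ)) (Finset (Orb Λ)) ℂ) := by
    rw [totalNumberOp_eq_totalNumber]; exact hN
  exact mulVec_mem_eigenspace_of_commute hN' hv

/-- `S⁺` maps the `N`-particle sector into itself (`[N̂, S⁺] = 0`). [cite: Tasaki2020, §9.2] -/
theorem spinPlus_mulVec_mem_nParticleSubmodule {N : ℕ} {v : Fock (Orb Λ)} (hv : v ∈ nParticleSubmodule N) :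
    (spinPlus : Matrix (Finset (Orb Λ)) (Finset (Orb Λ)) ℂ) *ᵥ v ∈ nParticleSubmodule N :=
  mulVec_mem_nParticleSubmodule_of_commute (LiebTwo.totalNumber_mul_spinPlus (Λ := Λ)).symm hv

/-- `S⁻` maps the `N`-particle sector into itself (`[N̂, S⁻] = 0`). [cite: Tasaki2020, §9.2] -/
theorem spinMinus_mulVec_mem_nParticleSubmodule {N : ℕ} {v : Fock (Orb Λ)} (hv : v ∈ nParticleSubmodule N) :
    (spinMinus : Matrix (Finset (Orb Λ)) (Finset (Orb Λ)) ℂ) *ᵥ v ∈ nParticleSubmodule N :=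
  mulVec_mem_nParticleSubmodule_of_commute (LiebTwo.totalNumber_mul_spinMinus (Λ := Λ)).symm hv

/-- `S^z` maps the `N`-particle sector into itself (`[N̂, S^z] = 0`). [cite: Tasaki2020, §9.2] -/
theorem spinZ_mulVec_mem_nParticleSubmodule {N : ℕ} {v : Fock (Orb Λ)} (hv : v ∈ nParticleSubmodule N) :
    (HubbardWave0.spinZ : Matrix (Finset (Orb Λ)) (Finset (Orb Λ)) ℂ) *ᵥ v ∈ nParticleSubmodule N :=
  mulVec_mem_nParticleSubmodule_of_commute spinZ_commute_totalNumber hv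

/-- `N̂` acts as the scalar `N` on the `N`-particle sector (in particular it preserves it). [cite: Tasaki2020, §9.2] -/
theorem totalNumber_mulVec_of_mem_nParticleSubmodule {N : ℕ} {v : Fock (Orb Λ)} (hv : v ∈ nParticleSubmodule N) :
    (totalNumber : Matrix (Finset (Orb Λ)) (Finset (Orb Λ)) ℂ) *ᵥ v = (N : ℂ) • v :=
  totalNumber_mulVec_of_isNParticle ((mem_nParticleSubmodule_iff N v).1 hv)

/-- A Fock relabelling unitary `U_π` maps the `N`-particle sector into itself (Bogoliubov automorphisms of
one-particle bijections conserve the particle number). [cite: BratteliRobinsonII1997, §5.2.2] -/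
theorem fockRelabel_mulVec_mem_nParticleSubmodule (π : Equiv.Perm (Orb Λ)) {N : ℕ} {v : Fock (Orb Λ)}
    (hv : v ∈ nParticleSubmodule N) : (fockRelabel π).val *ᵥ v ∈ nParticleSubmodule N :=
  (mem_nParticleSubmodule_iff N _).2 (((mem_nParticleSubmodule_iff N v).1 hv).fockRelabel_mulVec π)

/-- The joint sector `(N, S^z = M)` lies in the `N`-particle sector. [cite: LiebPRL1989, eq. (2)] -/
theorem szSector_le_nParticleSubmodule (N : ℕ) (M : ℝ) :
    (szSector N M : Submodule ℂ (Fock (Orb Λ))) ≤ nParticleSubmodule N := fun v hv =>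
  (mem_nParticleSubmodule_iff N v).2 ((mem_szSector_iff N M v).1 hv).1

end NSector

/-! ### Torus: `S^±` locality, sector facts, `S^±`-symmetry of the `t–t'` Hamiltonian -/

section Torus

variable {d L : ℕ} [NeZero L]

/-- (Local to this file, as in `HubbardNNNHoppingWindowCertificate` / `HubbardWindowCertificateD4`.) Torus sites
are compared through the linear order, the instance carried by the orbital-generic lemmas. [folklore] -/
local instance (priority := high) instDecidableEqFermionTorusWardD4 : DecidableEq (FermionTorus d L) :=
  LinearOrder.toDecidableEq

/-- **`S⁺` commutators with embedded observables are embedded local commutators**: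
`S⁺ ΓA − ΓA S⁺ = Γ(S⁺_Λ A − A S⁺_Λ)` for every local `A ∈ 𝔄_Λ` embedded in the torus (`x ↦ x mod L`
injective on `Λ`): the on-site terms `c†_{a↑} c_{a↓}` off the image are even and far from `ΓA`.
[cite: BratteliRobinsonII1997, Thm. 6.2.4] -/
theorem spinPlus_commutator_fermionEmbed_toTorusEmb {Λ : Finset (Site d)}
    (h : Set.InjOn (Torus.proj (d := d) L) ↑Λ) (A : FermionOp Λ) :
    (spinPlus : Matrix (Finset (Orb (FermionTorus d L))) (Finset (Orb (FermionTorus d L))) ℂ) *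
          fermionEmbed (PolySite.toTorusEmb L h) A -
        fermionEmbed (PolySite.toTorusEmb L h) A * spinPlus =
      fermionEmbed (PolySite.toTorusEmb L h) ((spinPlus : FermionOp Λ) * A - A * spinPlus) := by
  rw [← sum_fermionSpinPlus, ← sum_fermionSpinPlus]
  exact sum_commutator_fermionEmbed_toTorusEmb L h A (fun a => fermionSpinPlus a) (fun p => fermionSpinPlus p)
    (fun a => creation_mul_annihilation_mem_carEvenSubalgebra (orb_mem_orbs.2 (Finset.mem_singleton_self a))
      (orb_mem_orbs.2 (Finset.mem_singleton_self a)))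
    (fun p => fermionEmbed_fermionSpinPlus _ p)

/-- **`S⁻` commutators with embedded observables**: `S⁻ ΓA − ΓA S⁻ = Γ(S⁻_Λ A − A S⁻_Λ)`.
[cite: BratteliRobinsonII1997, Thm. 6.2.4] -/
theorem spinMinus_commutator_fermionEmbed_toTorusEmb {Λ : Finset (Site d)}
    (h : Set.InjOn (Torus.proj (d := d) L) ↑Λ) (A : FermionOp Λ) :
    (spinMinus : Matrix (Finset (Orb (FermionTorus d L))) (Finset (Orb (FermionTorus d L))) ℂ) *
          fermionEmbed (PolySite.toTorusEmb L h) A -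
        fermionEmbed (PolySite.toTorusEmb L h) A * spinMinus =
      fermionEmbed (PolySite.toTorusEmb L h) ((spinMinus : FermionOp Λ) * A - A * spinMinus) := by
  rw [← sum_fermionSpinMinus, ← sum_fermionSpinMinus]
  exact sum_commutator_fermionEmbed_toTorusEmb L h A (fun a => fermionSpinMinus a) (fun p => fermionSpinMinus p)
    (fun a => creation_mul_annihilation_mem_carEvenSubalgebra (orb_mem_orbs.2 (Finset.mem_singleton_self a))
      (orb_mem_orbs.2 (Finset.mem_singleton_self a)))
    (fun p => fermionEmbed_fermionSpinMinus _ p)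

/-- The `t–t'` torus Hamiltonian commutes with `S⁺` (both hopping graphs carry an `SU(2)`-invariant Hubbard
Hamiltonian). [cite: LiebPRL1989, eq. (2)] -/
theorem hubbardTorusTT'_commute_spinPlus (L : ℕ) (t t' U : ℝ) :
    Commute (hubbardTorusTT' L t t' U) spinPlus :=
  (LiebThm1.hamiltonian_commute_spinPlus (fermionTorusGraph 2 L) t U).add_left
    (LiebThm1.hamiltonian_commute_spinPlus (fermionTorusDiagGraph L) t' 0)

/-- The `t–t'` torus Hamiltonian commutes with `S⁻`. [cite: LiebPRL1989, eq. (2)] -/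
theorem hubbardTorusTT'_commute_spinMinus (L : ℕ) (t t' U : ℝ) :
    Commute (hubbardTorusTT' L t t' U) spinMinus :=
  (LiebThm1.hamiltonian_commute_spinMinus (fermionTorusGraph 2 L) t U).add_left
    (LiebThm1.hamiltonian_commute_spinMinus (fermionTorusDiagGraph L) t' 0)

/-- The `t–t'` torus Hamiltonian preserves the `N`-particle sector. [cite: Tasaki2020, §9.2] -/
theorem mulVec_hubbardTorusTT'_mem_nParticleSubmodule (L : ℕ) (t t' U : ℝ) {N : ℕ}
    {ψ : Fock (Orb (FermionTorus 2 L))} (hψ : ψ ∈ nParticleSubmodule N) :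
    hubbardTorusTT' L t t' U *ᵥ ψ ∈ nParticleSubmodule N :=
  mulVec_mem_nParticleSubmodule_of_commute (hubbardTorusTT'_commute_totalNumber L t t' U) hψ

/-- The translation unitaries preserve the `N`-particle sector. [cite: BratteliRobinsonII1997, §5.2.2] -/
theorem fockTranslate_mulVec_mem_nParticleSubmodule (v : TorusSite d L) {N : ℕ}
    {ψ : Fock (Orb (FermionTorus d L))} (hψ : ψ ∈ nParticleSubmodule N) :
    (fockTranslate v).val *ᵥ ψ ∈ nParticleSubmodule N :=
  fockRelabel_mulVec_mem_nParticleSubmodule _ hψ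

/-- The adjoint translation unitaries preserve the `N`-particle sector. [cite: BratteliRobinsonII1997, §5.2.2] -/
theorem fockTranslate_conjTranspose_mulVec_mem_nParticleSubmodule (v : TorusSite d L) {N : ℕ}
    {ψ : Fock (Orb (FermionTorus d L))} (hψ : ψ ∈ nParticleSubmodule N) :
    (fockTranslate v).valᴴ *ᵥ ψ ∈ nParticleSubmodule N := by
  rw [fockTranslate_val_conjTranspose]
  exact fockTranslate_mulVec_mem_nParticleSubmodule (-v) hψ

/-- The affine-`D₄` unitaries `U_w D_γ` preserve the `N`-particle sector. [cite: BratteliRobinsonII1997, §5.2.2] -/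
theorem d4Affine_mulVec_mem_nParticleSubmodule (γ : DihedralGroup 4) (w : TorusSite 2 L) {N : ℕ}
    {ψ : Fock (Orb (FermionTorus 2 L))} (hψ : ψ ∈ nParticleSubmodule N) :
    ((fockTranslate w).val * (fockD4 (L := L) γ).val) *ᵥ ψ ∈ nParticleSubmodule N := by
  rw [← mulVec_mulVec]
  exact fockTranslate_mulVec_mem_nParticleSubmodule w (fockRelabel_mulVec_mem_nParticleSubmodule _ hψ)

/-- The adjoint affine-`D₄` unitaries preserve the `N`-particle sector. [cite: BratteliRobinsonII1997, §5.2.2] -/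
theorem d4Affine_conjTranspose_mulVec_mem_nParticleSubmodule (γ : DihedralGroup 4) (w : TorusSite 2 L) {N : ℕ}
    {ψ : Fock (Orb (FermionTorus 2 L))} (hψ : ψ ∈ nParticleSubmodule N) :
    ((fockTranslate w).val * (fockD4 (L := L) γ).val)ᴴ *ᵥ ψ ∈ nParticleSubmodule N := by
  rw [conjTranspose_mul, fockD4_val_conjTranspose, fockTranslate_val_conjTranspose, ← mulVec_mulVec]
  exact fockRelabel_mulVec_mem_nParticleSubmodule _ (fockTranslate_mulVec_mem_nParticleSubmodule (-w) hψ)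

omit [NeZero L] in
/-- The `N`-particle sector of the torus is non-trivial for even `N = 2n`, `n ≤ |FermionTorus d L|`
(it contains the joint sector `(2n, S^z = 0)`). [cite: LiebPRL1989, eq. (2)] -/
theorem nParticleSubmodule_two_mul_ne_bot {nh : ℕ} (hn : nh ≤ Fintype.card (FermionTorus d L)) :
    (nParticleSubmodule (2 * nh) : Submodule ℂ (Fock (Orb (FermionTorus d L)))) ≠ ⊥ := by
  have h := szSector_ne_bot (d := d) (L := L) 0 0 hn
  rw [Submodule.ne_bot_iff] at h ⊢
  obtain ⟨ψ, hψ, hψ0⟩ := h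
  exact ⟨ψ, szSector_le_nParticleSubmodule _ _ hψ, hψ0⟩

omit [NeZero L] in
/-- The ground-state energy of the `2n`-particle sector is `minEnergyOn` of the `N`-particle submodule
(the wave-0 `groundEnergy` read as a sector minimum; Lieb 1989 §2's sector ground energies). [cite: LiebPRL1989, eq. (2)] -/
theorem groundEnergy_eq_minEnergyOn_nParticleSubmodule
    (H : Matrix (Finset (Orb (FermionTorus d L))) (Finset (Orb (FermionTorus d L))) ℂ) (N : ℕ) :
    groundEnergy H N = H.minEnergyOn (nParticleSubmodule N) :=
  groundEnergy_eq_minEnergyOn H N _ (fun ψ => mem_nParticleSubmodule_iff N ψ)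

/-! ### The SU(2)-Ward × affine-`D₄` window certificate ⇒ energy per site of every large `t–t'` torus -/

/-- **SU(2)-Ward × affine-`D₄` window certificate ⇒ energy per site of every large `t–t'` torus** (stub W2
`stub_wardTorus_of_generic` of the Ventures crux line `wardk`, stated with the line's `GenericSectorTorusCert` as
hypothesis `hgen` and its `WardD4Identity`/`WardD4TorusCert` bodies inlined, so the registered stub closes by `exact`).
Fix a window `Λ' ⊆ ℤ²` containing `thicken {0} 1`, an inner region `Λ ⊆ Λ'` with `thicken Λ 1 ⊆ Λ'`, affine-`D₄`
regions `γₗΛ + wₗ ⊆ Λ'`, ONE real multiplier `μ` on the total site density `n_{0↑} + n_{0↓}` with target `n`, and the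
identity in `𝔄_{Λ'}`
`Γ(incl) E^{tt'}_Φ − c·1 − μ (n_{0↑} + n_{0↓} − n·1) = Σ Λₐᵦ Oₐᴴ O_b + (Σₖ (H^{tt'}_{Λ'} Bₖ − Bₖ H^{tt'}_{Λ'})
   + Σₗ (Γ(incl)(Γ(d4Emb γₗ wₗ) Yₗ) − Γ(incl) Yₗ) + Σⱼ bⱼ • wⱼ + Σᵣ (S⁺_{Λ'} X_r − X_r S⁺_{Λ'}) + Σᵣ (S⁻_{Λ'} X'_r − X'_r S⁻_{Λ'}))
   + (Σₘ dₘ • (Vₘᴴ − Vₘ) + Σₖ aₖ • vₖ)`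
(`Λ ⪰ 0`, charged ladder words `wⱼ`, ARBITRARY `X_r, X'_r ∈ 𝔄_{Λ'}` — the SU(2)-Ward null family — real `dₘ`,
ladder words `vₖ`). Then for every `L ≥ 3` with `x ↦ x mod L` injective on `thicken Λ' 1` and every `nh ≤ L²`:
`c − Σₖ ‖aₖ‖ + μ ((2 nh)/L² − n) ≤ groundEnergy (hubbardTorusTT' L t t' U) (2 nh) / L²`.
Proof = the proof of `groundEnergy_hubbardTorusTT'_div_ge_of_window_certificate_d4` read in the FULL `2nh`-particle
sector `K = nParticleSubmodule (2 nh)` (all `S^z`; `S^±` preserve it, `N̂ = 2nh` on it, and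
`minEnergyOn K = groundEnergy · (2nh)` by definition) through the generic-sector torus theorem `hgen`, with the two
Ward families transported by `S^± ΓX − ΓX S^± = Γ(S^±_{Λ'} X − X S^±_{Λ'})` into the commutator slot
`Σⱼ (Cⱼ Wⱼ − Wⱼ Cⱼ)`, `Cⱼ ∈ {N̂, S^z, S⁺, S⁻}` (all commute with `H` and preserve `K`). Han 2020 §2–3 ("null
constraints from symmetries and conserved charges") for the `t–t'` model of Xu et al. (2024) eq. (1), read on the
periodic box through the tracial sector ground state of the `2nh`-particle sector. [cite: Han2020Bootstrap, §3] -/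
theorem wardD4TorusCert_of_genericSectorTorusCert
    (hgen :
      ∀ (d L : ℕ) [NeZero L]
      (A : Matrix (Finset (Orb (FermionTorus d L))) (Finset (Orb (FermionTorus d L))) ℂ) (_hA : A.IsHermitian)
      (K : Submodule ℂ (Fock (Orb (FermionTorus d L)))) (_hK : K ≠ ⊥)
      (_hKA : ∀ ψ ∈ K, A *ᵥ ψ ∈ K)
      (_hKT : ∀ v : TorusSite d L, ∀ ψ ∈ K, (fockTranslate v).val *ᵥ ψ ∈ K)
      (_hKT' : ∀ v : TorusSite d L, ∀ ψ ∈ K, (fockTranslate v).valᴴ *ᵥ ψ ∈ K)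
      (_hAT : ∀ v : TorusSite d L, (fockTranslate v).val * A = A * (fockTranslate v).val)
      (X : Matrix (Finset (Orb (FermionTorus d L))) (Finset (Orb (FermionTorus d L))) ℂ)
      (_hsum : ∑ v : TorusSite d L, (fockTranslate v).val * X * (fockTranslate v).valᴴ = A)
      (δ' : Type) (dens : Finset δ') (μ ν g : δ' → ℝ)
      (D G : δ' → Matrix (Finset (Orb (FermionTorus d L))) (Finset (Orb (FermionTorus d L))) ℂ)
      (_hD : ∀ i ∈ dens, ∑ v : TorusSite d L, (fockTranslate v).val * D i * (fockTranslate v).valᴴ = G i)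
      (_hGh : ∀ i ∈ dens, (G i).IsHermitian)
      (_hG : ∀ i ∈ dens, ∀ ψ ∈ K, G i *ᵥ ψ = ((g i : ℝ) : ℂ) • ψ)
      (m : Type) (_ : Fintype m) (_ : DecidableEq m) (Λm : Matrix m m ℂ) (_hΛ : Λm.PosSemidef)
      (O : m → Matrix (Finset (Orb (FermionTorus d L))) (Finset (Orb (FermionTorus d L))) ℂ)
      (κ : Type) (s : Finset κ) (Xc : κ → Matrix (Finset (Orb (FermionTorus d L))) (Finset (Orb (FermionTorus d L))) ℂ)
      (ι : Type) (tt : Finset ι) (Us Y : ι → Matrix (Finset (Orb (FermionTorus d L))) (Finset (Orb (FermionTorus d L))) ℂ)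
      (_hU : ∀ l ∈ tt, Us l * A = A * Us l)
      (_hUK : ∀ l ∈ tt, ∀ ψ ∈ K, Us l *ᵥ ψ ∈ K)
      (_hUK' : ∀ l ∈ tt, ∀ ψ ∈ K, (Us l)ᴴ *ᵥ ψ ∈ K)
      (_hUU : ∀ l ∈ tt, (Us l)ᴴ * Us l = 1)
      (ρ : Type) (r : Finset ρ) (Q Z Z' : ρ → Matrix (Finset (Orb (FermionTorus d L))) (Finset (Orb (FermionTorus d L))) ℂ)
      (q : ρ → ℝ)
      (_hQh : ∀ i ∈ r, (Q i).IsHermitian)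
      (_hQ : ∀ i ∈ r, ∀ ψ ∈ K, Q i *ᵥ ψ = ((q i : ℝ) : ℂ) • ψ)
      (γ : Type) (u : Finset γ) (C W : γ → Matrix (Finset (Orb (FermionTorus d L))) (Finset (Orb (FermionTorus d L))) ℂ)
      (_hC : ∀ j ∈ u, C j * A = A * C j)
      (_hCK : ∀ j ∈ u, ∀ ψ ∈ K, C j *ᵥ ψ ∈ K)
      (_hCK' : ∀ j ∈ u, ∀ ψ ∈ K, (C j)ᴴ *ᵥ ψ ∈ K)
      (δ : Type) (ah : Finset δ) (dc : δ → ℝ) (V : δ → Matrix (Finset (Orb (FermionTorus d L))) (Finset (Orb (FermionTorus d L))) ℂ)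
      (κ'' : Type) (w : Finset κ'') (a : κ'' → ℂ)
      (M : κ'' → Matrix (Finset (Orb (FermionTorus d L))) (Finset (Orb (FermionTorus d L))) ℂ)
      (_hM : ∀ k ∈ w, (M k).IsContraction) (c : ℝ),
      X - (c : ℂ) • (1 : Matrix (Finset (Orb (FermionTorus d L))) (Finset (Orb (FermionTorus d L))) ℂ) -
          ∑ i ∈ dens, ((μ i : ℝ) : ℂ) • (D i - ((ν i : ℝ) : ℂ) •
            (1 : Matrix (Finset (Orb (FermionTorus d L))) (Finset (Orb (FermionTorus d L))) ℂ)) =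
        gramForm Λm O +
          (∑ k ∈ s, (A * Xc k - Xc k * A) +
            ∑ l ∈ tt, (Us l * Y l * (Us l)ᴴ - Y l) +
            ∑ i ∈ r, (Z i * (Q i - ((q i : ℝ) : ℂ) • 1) + (Q i - ((q i : ℝ) : ℂ) • 1) * Z' i) +
            ∑ j ∈ u, (C j * W j - W j * C j)) +
          (∑ m' ∈ ah, ((dc m' : ℝ) : ℂ) • ((V m')ᴴ - V m') + ∑ k ∈ w, a k • M k) →
      c - ∑ k ∈ w, ‖a k‖ + ∑ i ∈ dens, μ i * (g i / (L : ℝ) ^ d - ν i) ≤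
        A.minEnergyOn K / (L : ℝ) ^ d) :
    ∀ (t t' U : ℝ) (L : ℕ) [NeZero L], 3 ≤ L →
    ∀ (nh : ℕ), nh ≤ Fintype.card (FermionTorus 2 L) →
    ∀ (n : ℝ) (Λ Λ' : Finset (Site 2)) (hΛ : Λ ⊆ Λ') (_h8 : thicken Λ 1 ⊆ Λ')
      (h0 : thicken ({0} : Finset (Site 2)) 1 ⊆ Λ') (hz : (0 : Site 2) ∈ Λ')
      (_hInj : Set.InjOn (Torus.proj (d := 2) L) ↑(thicken Λ' 1))
      (μ : ℝ)
      (m : Type) (_ : Fintype m) (_ : DecidableEq m) (Λm : Matrix m m ℂ) (_hΛm : Λm.PosSemidef)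
      (O : m → FermionOp Λ')
      (κ : Type) (s : Finset κ) (B : κ → FermionOp Λ)
      (ι : Type) (tt : Finset ι) (γ : ι → DihedralGroup 4) (wv : ι → Site 2)
      (hsh : ∀ l, d4ShiftSet (γ l) (wv l) Λ ⊆ Λ') (Y : ι → FermionOp Λ)
      (ρ : Type) (u : Finset ρ) (b : ρ → ℂ) (cw : ρ → List (Orb (PolySite Λ') × Bool))
      (_hcw : ∀ j ∈ u, ladderCharge (cw j) ≠ 0 ∨ ladderSpinCharge (cw j) ≠ 0)
      (θ : Type) (wp : Finset θ) (Xp : θ → FermionOp Λ')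
      (θ' : Type) (wm : Finset θ') (Xm : θ' → FermionOp Λ')
      (δ : Type) (ah : Finset δ) (dc : δ → ℝ) (V : δ → FermionOp Λ')
      (κ'' : Type) (w : Finset κ'') (a : κ'' → ℂ) (word : κ'' → List (Orb (PolySite Λ') × Bool))
      (c : ℝ),
        fermionEmbed (PolySite.incl h0) ((hubbardTTPrimeFermionInteraction t t' U).meanEnergyObs 1) -
            (c : ℂ) • (1 : FermionOp Λ') -
            ((μ : ℝ) : ℂ) • (nAt 0 hz 0 + nAt 0 hz 1 - ((n : ℝ) : ℂ) • (1 : FermionOp Λ')) =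
          gramForm Λm O +
            (∑ k ∈ s, ((hubbardTTPrimeFermionInteraction t t' U).localHamiltonian Λ' * fermionEmbed (PolySite.incl hΛ) (B k) -
                fermionEmbed (PolySite.incl hΛ) (B k) * (hubbardTTPrimeFermionInteraction t t' U).localHamiltonian Λ') +
              ∑ l ∈ tt, (fermionEmbed (PolySite.incl (hsh l)) (fermionEmbed (PolySite.d4Emb (γ l) (wv l) Λ) (Y l)) -
                fermionEmbed (PolySite.incl hΛ) (Y l)) +
              ∑ j ∈ u, b j • ladderWord (cw j) +
              ∑ r ∈ wp, ((spinPlus : FermionOp Λ') * Xp r - Xp r * (spinPlus : FermionOp Λ')) +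
              ∑ r ∈ wm, ((spinMinus : FermionOp Λ') * Xm r - Xm r * (spinMinus : FermionOp Λ'))) +
            (∑ m' ∈ ah, ((dc m' : ℝ) : ℂ) • ((V m')ᴴ - V m') + ∑ k ∈ w, a k • ladderWord (word k)) →
      c - ∑ k ∈ w, ‖a k‖ + μ * ((((2 * nh : ℕ) : ℝ)) / (L : ℝ) ^ 2 - n) ≤
        groundEnergy (hubbardTorusTT' L t t' U) (2 * nh) / (L : ℝ) ^ 2 := by
  intro t t' U L _ hL nh hn n Λ Λ' hΛ h8 h0 hz hInj μ m _ _ Λm hΛm O κ s B ι tt γ wv hsh Y ρ u b cw hcw θ wp Xp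
    θ' wm Xm δ ah dc V κ'' w a word c hcert
  -- the pull-back homomorphism and its restrictions
  have hInj' : Set.InjOn (Torus.proj (d := 2) L) ↑Λ' := hInj.mono (by exact_mod_cast subset_thicken Λ' 1)
  have hInjΛ : Set.InjOn (Torus.proj (d := 2) L) ↑Λ := hInj'.mono (by exact_mod_cast hΛ)
  have hInj0 : Set.InjOn (Torus.proj (d := 2) L) ↑(thicken ({0} : Finset (Site 2)) 1) :=
    hInj'.mono (by exact_mod_cast h0)
  set Γ' := fermionEmbed (PolySite.toTorusEmb L hInj') with hΓ'
  set ΓΛ := fermionEmbed (PolySite.toTorusEmb L hInjΛ) with hΓΛ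
  set H := hubbardTorusTT' L t t' U with hH
  set EΦ := (hubbardTTPrimeFermionInteraction t t' U).meanEnergyObs 1 with hEΦ
  set K : Submodule ℂ (Fock (Orb (FermionTorus 2 L))) := nParticleSubmodule (2 * nh) with hKdef
  -- the objective: its translates sum to `H`
  set X := Γ' (fermionEmbed (PolySite.incl h0) EΦ) with hX
  have hX0 : X = fermionEmbed (PolySite.toTorusEmb L hInj0) EΦ := fermionEmbed_toTorusEmb_incl h0 hInj' EΦ
  have hsum : ∑ v' : TorusSite 2 L, (fockTranslate v').val * X * (fockTranslate v').valᴴ = H := by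
    rw [hX0]
    have h := sum_relabel_translate_hubbardTTPrime_meanEnergyObs (L := L) t' t U hL
    simp_rw [relabel_eq_fockRelabel_conj] at h
    exact h
  -- the density observable `n_{0↑} + n_{0↓}`: its translates sum to `N̂`, the scalar `2nh` on `K`
  set D0 : Fin 2 → Matrix (Finset (Orb (FermionTorus 2 L))) (Finset (Orb (FermionTorus 2 L))) ℂ :=
    fun σ => numberOp (FermionTorus.ofTorusSite (0 : TorusSite 2 L)) σ with hD0
  set D : Fin 1 → Matrix (Finset (Orb (FermionTorus 2 L))) (Finset (Orb (FermionTorus 2 L))) ℂ :=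
    fun _ => D0 0 + D0 1 with hD
  set G : Fin 1 → Matrix (Finset (Orb (FermionTorus 2 L))) (Finset (Orb (FermionTorus 2 L))) ℂ :=
    fun _ => totalNumber with hG
  have hDΓ : ∀ σ, Γ' (nAt 0 hz σ) = D0 σ := fun σ => fermionEmbed_toTorusEmb_nAt_zero hz hInj' σ
  have hDsum : ∀ i ∈ (Finset.univ : Finset (Fin 1)),
      ∑ v' : TorusSite 2 L, (fockTranslate v').val * D i * (fockTranslate v').valᴴ = G i := by
    intro i _
    simp only [hD, hG, Matrix.mul_add, Matrix.add_mul, Finset.sum_add_distrib]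
    rw [sum_conj_fockTranslate_numberOp 0 0, sum_conj_fockTranslate_numberOp 0 1,
      totalNumber_eq_spinNumber_add_spinNumber]
  have hGh : ∀ i ∈ (Finset.univ : Finset (Fin 1)), (G i).IsHermitian := by
    intro i _
    simp only [hG]
    rw [totalNumber_eq_spinNumber_add_spinNumber]
    exact (isHermitian_sum_numberOp 0).add (isHermitian_sum_numberOp 1)
  have hGs : ∀ i ∈ (Finset.univ : Finset (Fin 1)), ∀ ψ ∈ K, G i *ᵥ ψ = ((((2 * nh : ℕ) : ℝ) : ℝ) : ℂ) • ψ := by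
    intro i _ ψ hψ
    simp only [hG]
    rw [totalNumber_mulVec_of_mem_nParticleSubmodule hψ]
    push_cast
    rfl
  -- symmetry family: affine `D₄` maps
  set Us : ι → Matrix (Finset (Orb (FermionTorus 2 L))) (Finset (Orb (FermionTorus 2 L))) ℂ :=
    fun l => (fockTranslate (Torus.proj L (wv l))).val * (fockD4 (L := L) (γ l)).val with hUs
  set Yt : ι → Matrix (Finset (Orb (FermionTorus 2 L))) (Finset (Orb (FermionTorus 2 L))) ℂ :=
    fun l => ΓΛ (Y l) with hYt
  have hU : ∀ l ∈ tt, Us l * H = H * Us l := fun l _ => d4Affine_mul_hubbardTorusTT' _ _ t t' U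
  have hUK : ∀ l ∈ tt, ∀ ψ ∈ K, Us l *ᵥ ψ ∈ K := fun l _ ψ hψ => d4Affine_mulVec_mem_nParticleSubmodule _ _ hψ
  have hUK' : ∀ l ∈ tt, ∀ ψ ∈ K, (Us l)ᴴ *ᵥ ψ ∈ K := fun l _ ψ hψ =>
    d4Affine_conjTranspose_mulVec_mem_nParticleSubmodule _ _ hψ
  have hUU : ∀ l ∈ tt, (Us l)ᴴ * Us l = 1 := fun l _ => d4Affine_conjTranspose_mul_self _ _
  -- charge family, part 1: charged words as commutators with `N̂` / `S^z`
  set emb : Orb (PolySite Λ') × Bool → Orb (FermionTorus 2 L) × Bool :=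
    fun p => (Orb.embMap (PolySite.toTorusEmb L hInj') p.1, p.2) with hemb
  set Cq : ρ → Matrix (Finset (Orb (FermionTorus 2 L))) (Finset (Orb (FermionTorus 2 L))) ℂ :=
    fun j => if ladderCharge ((cw j).map emb) ≠ 0 then totalNumber else HubbardWave0.spinZ with hCq
  set Wq : ρ → Matrix (Finset (Orb (FermionTorus 2 L))) (Finset (Orb (FermionTorus 2 L))) ℂ :=
    fun j => (b j / (if ladderCharge ((cw j).map emb) ≠ 0 then ((ladderCharge ((cw j).map emb) : ℤ) : ℂ)
      else ((ladderSpinCharge ((cw j).map emb) : ℤ) : ℂ) / 2)) • ladderWord ((cw j).map emb) with hWq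
  have hHN : Commute H totalNumber := hubbardTorusTT'_commute_totalNumber L t t' U
  have hHS : Commute H HubbardWave0.spinZ := hubbardTorusTT'_commute_spinZ L t t' U
  have hCq1 : ∀ j, Cq j * H = H * Cq j := by
    intro j
    by_cases hq : ladderCharge ((cw j).map emb) ≠ 0
    · simp only [hCq, hq, ne_eq, not_false_eq_true, if_true]; exact hHN.symm.eq
    · simp only [hCq, hq, if_false]; exact hHS.symm.eq
  have hCqK : ∀ j, ∀ ψ ∈ K, Cq j *ᵥ ψ ∈ K := by
    intro j ψ hψ
    by_cases hq : ladderCharge ((cw j).map emb) ≠ 0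
    · simp only [hCq, hq, ne_eq, not_false_eq_true, if_true]
      rw [totalNumber_mulVec_of_mem_nParticleSubmodule hψ]
      exact Submodule.smul_mem _ _ hψ
    · simp only [hCq, hq, if_false]
      exact spinZ_mulVec_mem_nParticleSubmodule hψ
  have hCqh : ∀ j, (Cq j)ᴴ = Cq j := by
    intro j
    by_cases hq : ladderCharge ((cw j).map emb) ≠ 0
    · simp only [hCq, hq, ne_eq, not_false_eq_true, if_true]
      rw [totalNumber_eq_numberDiag_univ]
      exact numberDiag_conjTranspose _
    · simp only [hCq, hq, if_false]; exact HubbardWave0.spinZ_isHermitian.eq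
  have hcharged : ∀ j ∈ u, Γ' (b j • ladderWord (cw j)) = Cq j * Wq j - Wq j * Cq j := by
    intro j hj
    rw [map_smul, hΓ', fermionEmbed_ladderWord]
    have hl : ladderCharge ((cw j).map emb) ≠ 0 ∨ ladderSpinCharge ((cw j).map emb) ≠ 0 := by
      rw [hemb, ladderCharge_map_embMap, ladderSpinCharge_map_embMap]; exact hcw j hj
    exact smul_ladderWord_eq_commutator_of_charged (b j) _ hl
  -- charge family, part 2: the SU(2)-Ward families as commutators with `S⁺` / `S⁻`
  have hwardP : ∀ r ∈ wp, Γ' ((spinPlus : FermionOp Λ') * Xp r - Xp r * (spinPlus : FermionOp Λ')) =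
      spinPlus * Γ' (Xp r) - Γ' (Xp r) * spinPlus := fun r _ => by
    rw [hΓ', spinPlus_commutator_fermionEmbed_toTorusEmb hInj' (Xp r)]
  have hwardM : ∀ r ∈ wm, Γ' ((spinMinus : FermionOp Λ') * Xm r - Xm r * (spinMinus : FermionOp Λ')) =
      spinMinus * Γ' (Xm r) - Γ' (Xm r) * spinMinus := fun r _ => by
    rw [hΓ', spinMinus_commutator_fermionEmbed_toTorusEmb hInj' (Xm r)]
  -- the combined commutator family over `ρ ⊕ (θ ⊕ θ')`
  set C : ρ ⊕ (θ ⊕ θ') → Matrix (Finset (Orb (FermionTorus 2 L))) (Finset (Orb (FermionTorus 2 L))) ℂ :=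
    fun x => Sum.elim Cq (Sum.elim (fun _ => spinPlus) (fun _ => spinMinus)) x with hC
  set W : ρ ⊕ (θ ⊕ θ') → Matrix (Finset (Orb (FermionTorus 2 L))) (Finset (Orb (FermionTorus 2 L))) ℂ :=
    fun x => Sum.elim Wq (Sum.elim (fun r => Γ' (Xp r)) (fun r => Γ' (Xm r))) x with hW
  set uu : Finset (ρ ⊕ (θ ⊕ θ')) := u.disjSum (wp.disjSum wm) with huu
  have hC1 : ∀ x ∈ uu, C x * H = H * C x := by
    rintro (j | r | r) _
    · exact hCq1 j
    · exact (hubbardTorusTT'_commute_spinPlus L t t' U).symm.eq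
    · exact (hubbardTorusTT'_commute_spinMinus L t t' U).symm.eq
  have hCK : ∀ x ∈ uu, ∀ ψ ∈ K, C x *ᵥ ψ ∈ K := by
    rintro (j | r | r) _ ψ hψ
    · exact hCqK j ψ hψ
    · exact spinPlus_mulVec_mem_nParticleSubmodule hψ
    · exact spinMinus_mulVec_mem_nParticleSubmodule hψ
  have hCK' : ∀ x ∈ uu, ∀ ψ ∈ K, (C x)ᴴ *ᵥ ψ ∈ K := by
    rintro (j | r | r) _ ψ hψ
    · show (Cq j)ᴴ *ᵥ ψ ∈ K
      rw [hCqh j]; exact hCqK j ψ hψ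
    · show (spinPlus)ᴴ *ᵥ ψ ∈ K
      exact spinMinus_mulVec_mem_nParticleSubmodule hψ
    · show (spinMinus)ᴴ *ᵥ ψ ∈ K
      rw [spinMinus_conjTranspose]
      exact spinPlus_mulVec_mem_nParticleSubmodule hψ
  have hsumC : ∑ x ∈ uu, (C x * W x - W x * C x) =
      ∑ j ∈ u, (Cq j * Wq j - Wq j * Cq j) +
        (∑ r ∈ wp, (spinPlus * Γ' (Xp r) - Γ' (Xp r) * spinPlus) +
          ∑ r ∈ wm, (spinMinus * Γ' (Xm r) - Γ' (Xm r) * spinMinus)) := by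
    rw [huu, Finset.sum_disjSum, Finset.sum_disjSum]
    rfl
  -- residual words
  set Mw : κ'' → Matrix (Finset (Orb (FermionTorus 2 L))) (Finset (Orb (FermionTorus 2 L))) ℂ :=
    fun k => ladderWord ((word k).map emb) with hMw
  have hMc : ∀ k ∈ w, (Mw k).IsContraction := fun k _ => by
    rw [hMw]; dsimp only; rw [ladderWord_eq_prod]; exact isContraction_prod_ladder _
  -- the identity, pulled back into the torus
  have htorus : X - (c : ℂ) • (1 : Matrix (Finset (Orb (FermionTorus 2 L))) (Finset (Orb (FermionTorus 2 L))) ℂ) -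
      ∑ i ∈ (Finset.univ : Finset (Fin 1)), ((μ : ℝ) : ℂ) • (D i - ((n : ℝ) : ℂ) •
        (1 : Matrix (Finset (Orb (FermionTorus 2 L))) (Finset (Orb (FermionTorus 2 L))) ℂ)) =
      gramForm Λm (fun i => Γ' (O i)) +
        (∑ k ∈ s, (H * Γ' (fermionEmbed (PolySite.incl hΛ) (B k)) - Γ' (fermionEmbed (PolySite.incl hΛ) (B k)) * H) +
          ∑ l ∈ tt, (Us l * Yt l * (Us l)ᴴ - Yt l) +
          ∑ i ∈ (∅ : Finset (Fin 0)), ((0 : Matrix _ _ ℂ) * ((0 : Matrix _ _ ℂ) - (((0 : ℝ) : ℝ) : ℂ) • 1) +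
            ((0 : Matrix _ _ ℂ) - (((0 : ℝ) : ℝ) : ℂ) • 1) * (0 : Matrix _ _ ℂ)) +
          ∑ x ∈ uu, (C x * W x - W x * C x)) +
        (∑ m' ∈ ah, ((dc m' : ℝ) : ℂ) • ((Γ' (V m'))ᴴ - Γ' (V m')) + ∑ k ∈ w, a k • Mw k) := by
    have key := congrArg Γ' hcert
    -- left-hand side
    rw [map_sub, map_sub, map_smul, map_one, map_smul, map_sub, map_add, map_smul, map_one, hDΓ 0, hDΓ 1] at key
    have hlhs : ((μ : ℝ) : ℂ) • (D0 0 + D0 1 - ((n : ℝ) : ℂ) •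
          (1 : Matrix (Finset (Orb (FermionTorus 2 L))) (Finset (Orb (FermionTorus 2 L))) ℂ)) =
        ∑ i ∈ (Finset.univ : Finset (Fin 1)), ((μ : ℝ) : ℂ) • (D i - ((n : ℝ) : ℂ) •
          (1 : Matrix (Finset (Orb (FermionTorus 2 L))) (Finset (Orb (FermionTorus 2 L))) ℂ)) := by
      rw [Finset.univ_unique, Finset.sum_singleton]
    rw [hlhs] at key
    -- right-hand side, family by family
    have h1 : Γ' (∑ k ∈ s, ((hubbardTTPrimeFermionInteraction t t' U).localHamiltonian Λ' * fermionEmbed (PolySite.incl hΛ) (B k) -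
        fermionEmbed (PolySite.incl hΛ) (B k) * (hubbardTTPrimeFermionInteraction t t' U).localHamiltonian Λ')) =
        ∑ k ∈ s, (H * Γ' (fermionEmbed (PolySite.incl hΛ) (B k)) - Γ' (fermionEmbed (PolySite.incl hΛ) (B k)) * H) := by
      rw [map_sum]
      refine Finset.sum_congr rfl fun k _ => ?_
      rw [hH, hΓ', hubbardTorusTT'_commutator_fermionEmbed L t t' U hΛ h8 hInj (B k)]
    have h2 : Γ' (∑ l ∈ tt, (fermionEmbed (PolySite.incl (hsh l)) (fermionEmbed (PolySite.d4Emb (γ l) (wv l) Λ) (Y l)) -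
        fermionEmbed (PolySite.incl hΛ) (Y l))) = ∑ l ∈ tt, (Us l * Yt l * (Us l)ᴴ - Yt l) := by
      rw [map_sum]
      refine Finset.sum_congr rfl fun l _ => ?_
      rw [hUs, hYt, hΓΛ, hΓ']
      exact fermionEmbed_toTorusEmb_d4_sub hΛ (γ l) (wv l) (hsh l) hInj' (Y l)
    have h3 : Γ' (∑ j ∈ u, b j • ladderWord (cw j)) = ∑ j ∈ u, (Cq j * Wq j - Wq j * Cq j) := by
      rw [map_sum]
      exact Finset.sum_congr rfl hcharged
    have hP : Γ' (∑ r ∈ wp, ((spinPlus : FermionOp Λ') * Xp r - Xp r * (spinPlus : FermionOp Λ'))) =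
        ∑ r ∈ wp, (spinPlus * Γ' (Xp r) - Γ' (Xp r) * spinPlus) := by
      rw [map_sum]
      exact Finset.sum_congr rfl hwardP
    have hM : Γ' (∑ r ∈ wm, ((spinMinus : FermionOp Λ') * Xm r - Xm r * (spinMinus : FermionOp Λ'))) =
        ∑ r ∈ wm, (spinMinus * Γ' (Xm r) - Γ' (Xm r) * spinMinus) := by
      rw [map_sum]
      exact Finset.sum_congr rfl hwardM
    have h4 : Γ' (∑ m' ∈ ah, ((dc m' : ℝ) : ℂ) • ((V m')ᴴ - V m')) =
        ∑ m' ∈ ah, ((dc m' : ℝ) : ℂ) • ((Γ' (V m'))ᴴ - Γ' (V m')) := by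
      rw [map_sum]
      refine Finset.sum_congr rfl fun m' _ => ?_
      rw [map_smul, map_sub, hΓ', fermionEmbed_conjTranspose]
    have h5 : Γ' (∑ k ∈ w, a k • ladderWord (word k)) = ∑ k ∈ w, a k • Mw k := by
      rw [map_sum]
      refine Finset.sum_congr rfl fun k _ => ?_
      rw [map_smul, hMw, hΓ', fermionEmbed_ladderWord]
    rw [hX, key, map_add, map_add, map_add, map_add, map_add, map_add, map_add, hΓ', fermionEmbed_gramForm, ← hΓ',
      h1, h2, h3, hP, hM, h4, h5, Finset.sum_empty, add_zero, hsumC]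
    abel
  -- apply the generic-sector torus theorem in `K = nParticleSubmodule (2 nh)`
  have hA : H.IsHermitian := hubbardTorusTT'_isHermitian L t t' U
  have hKne : K ≠ ⊥ := nParticleSubmodule_two_mul_ne_bot hn
  have hKA : ∀ ψ ∈ K, H *ᵥ ψ ∈ K := fun ψ hψ => mulVec_hubbardTorusTT'_mem_nParticleSubmodule L t t' U hψ
  have hKT : ∀ v' : TorusSite 2 L, ∀ ψ ∈ K, (fockTranslate v').val *ᵥ ψ ∈ K := fun v' ψ hψ =>
    fockTranslate_mulVec_mem_nParticleSubmodule v' hψ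
  have hKT' : ∀ v' : TorusSite 2 L, ∀ ψ ∈ K, (fockTranslate v').valᴴ *ᵥ ψ ∈ K := fun v' ψ hψ =>
    fockTranslate_conjTranspose_mulVec_mem_nParticleSubmodule v' hψ
  have hAT : ∀ v' : TorusSite 2 L, (fockTranslate v').val * H = H * (fockTranslate v').val := fun v' =>
    (fockTranslate_commute_hubbardTorusTT' L v' t t' U).eq
  have hmain := hgen 2 L H hA K hKne hKA hKT hKT' hAT X hsum
    (Fin 1) Finset.univ (fun _ => μ) (fun _ => n) (fun _ => ((2 * nh : ℕ) : ℝ)) D G hDsum hGh hGs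
    m inferInstance inferInstance Λm hΛm (fun i => Γ' (O i))
    κ s (fun k => Γ' (fermionEmbed (PolySite.incl hΛ) (B k)))
    ι tt Us Yt hU hUK hUK' hUU
    (Fin 0) (∅ : Finset (Fin 0)) (fun _ => 0) (fun _ => 0) (fun _ => 0) (fun _ => 0)
    (fun i hi => absurd hi (Finset.notMem_empty i)) (fun i hi => absurd hi (Finset.notMem_empty i))
    (ρ ⊕ (θ ⊕ θ')) uu C W hC1 hCK hCK'
    δ ah dc (fun m' => Γ' (V m')) κ'' w a Mw hMc c htorus
  have hs : ∑ i ∈ (Finset.univ : Finset (Fin 1)), μ * ((((2 * nh : ℕ) : ℝ)) / (L : ℝ) ^ 2 - n) =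
      μ * ((((2 * nh : ℕ) : ℝ)) / (L : ℝ) ^ 2 - n) := by
    rw [Finset.univ_unique, Finset.sum_singleton]
  rw [hs, ← groundEnergy_eq_minEnergyOn_nParticleSubmodule H (2 * nh)] at hmain
  exact hmain

end Torus

end Literature.MathematicalPhysics.QuantumLattice

end
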